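import Summits.FinalStateConjecture.FinalStateConjecture.Theses.ZeroEnergyKerrOrBomb
import Summits.FinalStateConjecture.FinalStateConjecture.Theorems.ZeroEnergyKerrOrBombKerrZeroEnergyUntrappedKSEscape
import Summits.FinalStateConjecture.FinalStateConjecture.Theorems.ZeroEnergyKerrOrBombKerrZeroEnergyUntrappedKSPointwise
import Summits.FinalStateConjecture.FinalStateConjecture.Theorems.ZeroEnergyKerrOrBombKerrZeroEnergyUntrappedKSRadial
import Literature.Geometry.Lorentzian.KerrCarterConstant
import Literature.Geometry.Lorentzian.KerrRegionIISpeedBound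

/-!
# `KerrZeroEnergyUntrappedKS` (stmt-FinalStateConjecture-13857, route ZeroEnergyKerrOrBomb)

Proof of the support item `KerrZeroEnergyUntrappedKS` of the routes `ZeroEnergyKerrOrBomb` and
`AnalyticityInvadesErgoregion` of the Final State Conjecture, AS TYPED: for sub-extremal `(M, a)`,
`0 < δ < r₊ − r₋` and every compact `S ⊆ {r > r₊}` of the ingoing Kerr–Schild chart
`Kerr.region a (r₊ − δ)`, every maximal null geodesic `γ` on `s` with `γ̇ ≠ 0` and zero energy
`g(γ̇, ∂_{t*}) = 0` on `s` has a parameter `t ∈ s` with `γ t` outside the `∂_{t*}`-orbit of `S`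
(`kerrZeroEnergyUntrappedKS_proof`).

## The argument (Carter's first integrals at `E = 0`; O'Neill 1995, Ch. 4, §4.2)

Suppose `γ(s) ⊆ ⋃ₜ φₜ(S)`. Then `r ∘ γ` lies in a shell `[r₁, r₂]`, `r₁ > r₊`
(`KerrUntrapped.exists_radius_bounds_of_stationaryOrbit`). Along `γ` the Killing energies `E = 0`,
`L` and Carter's constant `𝒦` are conserved (`KerrCarterConstant.lean`); `L ≠ 0` since a null vector
with `E = L = 0` vanishes on `{r > r₊}` (`KerrUntrapped.eq_zero_of_null_of_ksEnergy_eq_zero_of_ksAngMom_eq_zero`,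
the DRSR vector `∂_{t*} + ω(r)Φ` being timelike there), and `𝒦 ≥ L² > 0`
(`KerrUntrapped.sq_ksAngMom_le_ksCarterK`).

1. *Completeness, `s = ℝ`.* Null vectors over the shell are uniformly controlled by
   `g(∂_{t*} + ω(r)Φ, γ̇) = ω(r) L` (`KerrUntrapped.exists_norm_le_of_null`), so `‖γ̇‖ ≤ B` on `s`;
   near a finite end of `s` the positions then stay in a compact slab–shell of the chart and the
   tangent lifts in a compact subset of `TM` (`OpensChart.exists_isCompact_tangentBundle`), which the
   escape lemma for maximal geodesics forbids (`isMaximalGeodesicOn_not_bddAbove_of_isCompact`,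
   `…_not_bddBelow_…`; O'Neill 1983, Ch. 5, Lemma 8).
2. *Radial motion.* With `ṙ = ρ = dr(γ̇)`, `ρ̇ = Hess r(γ̇, γ̇)` (`Kerr.hasDerivAt_radius_comp`,
   `Kerr.hasDerivAt_fderiv_radius_comp`), the radial equation `Σ²ρ² = a²L² − Δ(r)𝒦` and the
   turning-point sign `2Σ² Hess r(γ̇, γ̇) = −2(r − M)𝒦 < 0` at `ρ = 0` (`Kerr.delta_mul_hessAt_radius_eq`),
   the real-variable core `KerrUntrapped.radial_core` yields the contradiction.

## References

* B. O'Neill, *The geometry of Kerr black holes*, A K Peters 1995, Ch. 4, §4.2, Thm. 4.2.2.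
* B. Carter, Phys. Rev. 174 (1968) 1559–1571, §IV.
* B. O'Neill, *Semi-Riemannian geometry*, Academic Press 1983, Ch. 5, Lemma 8; Ch. 9, Lemma 26.
* M. Dafermos, I. Rodnianski, Y. Shlapentokh-Rothman, arXiv:1402.7034, Lemma 4.7.1.
-/

noncomputable section

set_option linter.dupNamespace false
set_option maxSynthPendingDepth 3

namespace Summit.FinalStateConjecture.FinalStateConjecture.Theorems

open Set Filter Metric Bundle Literature.Geometry.Lorentzian Literature.Geometry.Lorentzian.Kerr
  Literature.Geometry.Lorentzian.MetricCoord
open scoped Manifold ContDiff Topology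

namespace KerrUntrapped

/-- `|ω(r)| ≤ 2M|a| r₂ / r₁⁴` on the shell `r₁ ≤ r ≤ r₂` (`0 < r₁`, `0 ≤ M`), for the DRSR angular
velocity `ω(r) = 2Mar/(r² + a²)²`. -/
theorem abs_drsrAngularVelocity_le {M a r r₁ r₂ : ℝ} (hM : 0 ≤ M) (hr₁ : 0 < r₁) (h₁ : r₁ ≤ r)
    (h₂ : r ≤ r₂) : |drsrAngularVelocity M a r| ≤ 2 * M * |a| * r₂ / r₁ ^ 4 := by
  have hr : 0 < r := hr₁.trans_le h₁
  have hr₂ : 0 ≤ r₂ := hr.le.trans h₂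
  unfold drsrAngularVelocity
  rw [abs_div, abs_of_nonneg (by positivity : (0 : ℝ) ≤ (r ^ 2 + a ^ 2) ^ 2),
    show 2 * M * a * r = (2 * M * r) * a by ring, abs_mul, abs_of_nonneg (by positivity : 0 ≤ 2 * M * r)]
  have hnum : 2 * M * r * |a| ≤ 2 * M * |a| * r₂ := by
    have := abs_nonneg a
    nlinarith [mul_le_mul_of_nonneg_left h₂ (by positivity : 0 ≤ 2 * M * |a|)]
  have hden : r₁ ^ 4 ≤ (r ^ 2 + a ^ 2) ^ 2 := by
    have h1 : r₁ ^ 2 ≤ r ^ 2 := pow_le_pow_left₀ hr₁.le h₁ 2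
    nlinarith [sq_nonneg a, pow_pos hr₁ 2]
  exact div_le_div₀ (by positivity) hnum (by positivity) hden

end KerrUntrapped

open KerrUntrapped

/-- **`KerrZeroEnergyUntrappedKS`** (stmt-FinalStateConjecture-13857): in the ingoing Kerr–Schild chart
`{r > r₊ − δ}` of a sub-extremal Kerr black hole, `0 < δ < r₊ − r₋`, no maximal zero-energy null
geodesic with non-vanishing velocity stays, for its whole parameter domain, inside the `∂_{t*}`-orbit of
a compact subset of `{r > r₊}` (Carter's first integrals at `E = 0`: `𝒦 ≥ L² > 0`,
`Σ²ṙ² = a²L² − Δ𝒦` strictly decreasing in `r > M`; completeness from the escape lemma and the uniform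
control of null vectors by the timelike span of the Killing fields). O'Neill 1995, Ch. 4, §4.2;
Carter 1968, §IV. -/
theorem kerrZeroEnergyUntrappedKS_proof :
    Summit.FinalStateConjecture.FinalStateConjecture.Theses.ZeroEnergyKerrOrBomb.KerrZeroEnergyUntrappedKS := by
  intro _ M a δ hMa hδ hδr _ S hS hSsub γ s hγ hsne hnull
  by_contra hcon
  push Not at hcon
  -- instances
  set 𝓚 := spacetime M a (rPlus M a - δ) hMa.pos.le with h𝓚
  haveI : (smoothMetric M a (rPlus M a - δ)).HasLeviCivita :=
    inferInstanceAs ((spacetime M a (rPlus M a - δ) hMa.pos.le).metric.HasLeviCivita)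
  haveI : Fact ((1 : ℕ∞ω) ≤ ((⊤ : ℕ∞) : WithTop ℕ∞)) := ⟨by exact_mod_cast le_top⟩
  haveI : CovariantDerivative.ContMDiffCovariantDerivative 𝓚.metric.leviCivita 1 :=
    ⟨𝓚.metric.toPseudoRiemannianMetric.isLocallyContMDiff_leviCivita_holds 1
      (by rw [show ((1 : ℕ∞) : ℕ∞ω) + 1 = 2 by norm_num]; exact WithTop.coe_le_coe.2 le_top)
      univ isOpen_univ⟩
  have haM : |a| ≤ M := le_of_lt hMa
  have hMr : M ≤ rPlus M a := by
    unfold rPlus; linarith [Real.sqrt_nonneg (M ^ 2 - a ^ 2)]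
  obtain ⟨t₀, ht₀⟩ := hsne
  have hsc : s.OrdConnected := hγ.2.1
  -- the geodesic, read for the Carter files
  have hγ' : IsGeodesicOn (smoothMetric M a (rPlus M a - δ)).toPseudoRiemannianMetric.leviCivita γ s :=
    hγ.2.2.1
  -- (0) the shell
  have hSne : S.Nonempty := by
    obtain ⟨x, hx, -, -⟩ := mem_stationaryOrbit_stationaryField_iff.1 (hcon t₀ ht₀)
    exact ⟨x, hx⟩
  obtain ⟨r₁, r₂, hr₁, hr₁₂, hshell⟩ := exists_radius_bounds_of_stationaryOrbit hS hSne hSsub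
  have hrs : ∀ t ∈ s, r₁ ≤ radius a (γ t) ∧ radius a (γ t) ≤ r₂ := fun t ht ↦ hshell _ (hcon t ht)
  have hr₁pos : 0 < r₁ := (rPlus_pos hMa).trans hr₁
  have hMr₁ : M < r₁ := hMr.trans_lt hr₁
  -- notation along `γ`
  set w : ℝ → E4 := fun t ↦ velocity 𝓘(ℝ, E4) γ t with hw
  have hx : ∀ t, 0 < radius a (γ t) := fun t ↦ radius_pos_of_mem_region (γ t).2
  have hrp : ∀ t ∈ s, rPlus M a < radius a (γ t) := fun t ht ↦ hr₁.trans_le (hrs t ht).1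
  have hΔpos : ∀ t ∈ s, 0 < radius a (γ t) ^ 2 - 2 * M * radius a (γ t) + a ^ 2 := fun t ht ↦
    Ingoing.delta_pos_of_rPlus_lt haM (hrp t ht)
  have hnull' : ∀ t ∈ s, Kerr.bilin M a (γ t) (w t) (w t) = 0 := fun t ht ↦ (hnull t ht).1
  have hw0 : ∀ t ∈ s, w t ≠ 0 := fun t ht ↦ (hnull t ht).2.1
  have hE : ∀ t ∈ s, ksEnergy M a (γ t) (w t) = 0 := by
    intro t ht
    unfold ksEnergy
    rw [Kerr.bilin_symm, neg_eq_zero]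
    exact (hnull t ht).2.2
  -- (1) the constants of motion
  set L : ℝ := ksAngMom M a (γ t₀) (w t₀) with hL_def
  set K : ℝ := ksCarterK M a (γ t₀) (w t₀) with hK_def
  have hLt : ∀ t ∈ s, ksAngMom M a (γ t) (w t) = L := fun t ht ↦
    ksAngMom_eq_of_isGeodesicOn hγ' hsc ht ht₀
  have hKt : ∀ t ∈ s, ksCarterK M a (γ t) (w t) = K := fun t ht ↦
    ksCarterK_eq_of_isGeodesicOn hγ' hsc hnull' (fun σ hσ ↦ (hΔpos σ hσ).ne') ht ht₀
  have hL0 : L ≠ 0 := fun hL ↦ hw0 t₀ ht₀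
    (eq_zero_of_null_of_ksEnergy_eq_zero_of_ksAngMom_eq_zero hMa (hrp t₀ ht₀) (hnull' t₀ ht₀)
      (hE t₀ ht₀) hL)
  have hKL : L ^ 2 ≤ K :=
    sq_ksAngMom_le_ksCarterK (hx t₀) (hΔpos t₀ ht₀).ne' (hnull' t₀ ht₀) (hE t₀ ht₀)
  have hK : 0 < K := (lt_of_le_of_ne (sq_nonneg L) (Ne.symm (pow_ne_zero 2 hL0))).trans_le hKL
  -- (2) a uniform velocity bound on `s`
  obtain ⟨C, hC0, hC⟩ := exists_norm_le_of_null hMa r₂ hr₁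
  set Ω : ℝ := 2 * M * |a| * r₂ / r₁ ^ 4 with hΩ
  have hΩ0 : 0 ≤ Ω := by
    have := hMa.pos.le
    have : 0 ≤ r₂ := hr₁pos.le.trans hr₁₂
    positivity
  set B : ℝ := C * (Ω * |L|) with hB_def
  have hB0 : 0 ≤ B := by positivity
  have hB : ∀ t ∈ s, ‖w t‖ ≤ B := by
    intro t ht
    have h1 := hC (γ t) (w t) (hrs t ht).1 (hrs t ht).2 (hnull' t ht)
    rw [bilin_drsrVector_left, hE t ht, hLt t ht, neg_zero, zero_add, abs_mul] at h1
    refine h1.trans (mul_le_mul_of_nonneg_left ?_ hC0)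
    exact mul_le_mul_of_nonneg_right
      (abs_drsrAngularVelocity_le hMa.pos.le hr₁pos (hrs t ht).1 (hrs t ht).2) (abs_nonneg L)
  -- (3) completeness: `s = ℝ`
  have hcoe : ∀ t ∈ s, HasDerivAt (fun t' ↦ (γ t' : E4)) (w t) t := fun t ht ↦
    (hasDerivAt_coe_and_velocity hγ' ht).1
  have hpos_bound : ∀ t₁ ∈ s, ∀ t₂ ∈ s, t₁ ≤ t₂ →
      ‖(γ t₂ : E4) - (γ t₁ : E4)‖ ≤ B * (t₂ - t₁) := by
    intro t₁ ht₁ t₂ ht₂ h12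
    have hI : Icc t₁ t₂ ⊆ s := hsc.out ht₁ ht₂
    exact norm_image_sub_le_of_norm_deriv_le_segment' (f := fun t' ↦ (γ t' : E4))
      (fun x hx ↦ (hcoe x (hI hx)).hasDerivWithinAt)
      (fun x hx ↦ hB x (hI (Ico_subset_Icc_self hx))) t₂ (right_mem_Icc.2 h12)
  have hr₀r₁ : max (rPlus M a - δ) 0 < r₁ := max_lt (by linarith) hr₁pos
  have hsu : s = univ := by
    refine eq_univ_of_not_bddAbove_of_not_bddBelow hsc (fun hbdd ↦ ?_) (fun hbdd ↦ ?_)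
    · -- bounded above: the lifts for `t ≥ t₀` lie in a compact subset of `TM`
      set T : ℝ := |(γ t₀ : E4) 0| + B * (sSup s - t₀) with hT
      obtain ⟨𝒦, h𝒦, hin⟩ := OpensChart.exists_isCompact_tangentBundle
        (isCompact_shell (a := a) (r₂ := r₂) (T := T) hr₀r₁) B
      refine isMaximalGeodesicOn_not_bddAbove_of_isCompact hγ ht₀ h𝒦 (fun t ht htt ↦ ?_) hbdd
      have hmem : γ t ∈ (Subtype.val : region a (rPlus M a - δ) → E4) ⁻¹'
          {y : E4 | |y 0| ≤ T ∧ r₁ ≤ radius a y ∧ radius a y ≤ r₂} := by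
        show |(γ t : E4) 0| ≤ T ∧ r₁ ≤ radius a (γ t) ∧ radius a (γ t) ≤ r₂
        refine ⟨?_, (hrs t ht).1, (hrs t ht).2⟩
        have h1 := hpos_bound t₀ ht₀ t ht htt
        have h2 : t ≤ sSup s := le_csSup hbdd ht
        have h3 : |(γ t : E4) 0 - (γ t₀ : E4) 0| ≤ ‖(γ t : E4) - (γ t₀ : E4)‖ := by
          have h := PiLp.norm_apply_le ((γ t : E4) - (γ t₀ : E4)) 0
          have h4 : ((γ t : E4) - (γ t₀ : E4)) 0 = (γ t : E4) 0 - (γ t₀ : E4) 0 := rfl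
          rw [Real.norm_eq_abs, h4] at h
          exact h
        have h5 : B * (t - t₀) ≤ B * (sSup s - t₀) := mul_le_mul_of_nonneg_left (by linarith) hB0
        have h6 := abs_sub_abs_le_abs_sub ((γ t : E4) 0) ((γ t₀ : E4) 0)
        rw [hT]
        linarith
      exact hin (γ t) (w t) hmem (hB t ht)
    · -- bounded below: the lifts for `t ≤ t₀`
      set T : ℝ := |(γ t₀ : E4) 0| + B * (t₀ - sInf s) with hT
      obtain ⟨𝒦, h𝒦, hin⟩ := OpensChart.exists_isCompact_tangentBundle
        (isCompact_shell (a := a) (r₂ := r₂) (T := T) hr₀r₁) B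
      refine isMaximalGeodesicOn_not_bddBelow_of_isCompact hγ ht₀ h𝒦 (fun t ht htt ↦ ?_) hbdd
      have hmem : γ t ∈ (Subtype.val : region a (rPlus M a - δ) → E4) ⁻¹'
          {y : E4 | |y 0| ≤ T ∧ r₁ ≤ radius a y ∧ radius a y ≤ r₂} := by
        show |(γ t : E4) 0| ≤ T ∧ r₁ ≤ radius a (γ t) ∧ radius a (γ t) ≤ r₂
        refine ⟨?_, (hrs t ht).1, (hrs t ht).2⟩
        have h1 := hpos_bound t ht t₀ ht₀ htt
        have h2 : sInf s ≤ t := csInf_le hbdd ht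
        have h3 : |(γ t : E4) 0 - (γ t₀ : E4) 0| ≤ ‖(γ t₀ : E4) - (γ t : E4)‖ := by
          have h := PiLp.norm_apply_le ((γ t₀ : E4) - (γ t : E4)) 0
          have h4 : ((γ t₀ : E4) - (γ t : E4)) 0 = (γ t₀ : E4) 0 - (γ t : E4) 0 := rfl
          rw [Real.norm_eq_abs, h4, abs_sub_comm] at h
          exact h
        have h5 : B * (t₀ - t) ≤ B * (t₀ - sInf s) := mul_le_mul_of_nonneg_left (by linarith) hB0
        have h6 := abs_sub_abs_le_abs_sub ((γ t : E4) 0) ((γ t₀ : E4) 0)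
        rw [hT]
        linarith
      exact hin (γ t) (w t) hmem (hB t ht)
  have hts : ∀ t, t ∈ s := fun t ↦ by rw [hsu]; exact mem_univ t
  -- (4) the radial motion
  set f : ℝ → ℝ := fun t ↦ radius a (γ t) with hf_def
  set ρ : ℝ → ℝ := fun t ↦ fderiv ℝ (radius a) (γ t) (w t) with hρ_def
  set Hf : ℝ → ℝ := fun t ↦ hessAt (Kerr.bilin M a) (radius a) (γ t) (w t) (w t) with hHf_def
  set Sg : ℝ → ℝ := fun t ↦ blSigma a (E4.spatial (γ t : E4)) with hSg_def
  have hfd : ∀ t, HasDerivAt f (ρ t) t := fun t ↦ hasDerivAt_radius_comp hγ' (hts t)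
  have hρd : ∀ t, HasDerivAt ρ (Hf t) t := fun t ↦ hasDerivAt_fderiv_radius_comp hγ' (hts t)
  have hlo : ∀ t, r₁ ≤ f t := fun t ↦ (hrs t (hts t)).1
  have hSpos : ∀ t, 0 < Sg t := fun t ↦ blSigma_spatial_pos (hx t)
  have hSle : ∀ t, Sg t ≤ r₂ ^ 2 + a ^ 2 := by
    intro t
    have h1 := blSigma_spatial_le a (γ t : E4)
    have h2 : radius a (γ t) ^ 2 ≤ r₂ ^ 2 :=
      pow_le_pow_left₀ (hx t).le (hrs t (hts t)).2 2
    show blSigma a (E4.spatial (γ t : E4)) ≤ r₂ ^ 2 + a ^ 2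
    linarith
  have hSmax : 0 < r₂ ^ 2 + a ^ 2 := by
    have : 0 < r₂ := hr₁pos.trans_le hr₁₂
    positivity
  have hrad : ∀ t, Sg t ^ 2 * ρ t ^ 2 = (a * L) ^ 2 - (f t ^ 2 - 2 * M * f t + a ^ 2) * K := by
    intro t
    have hk := hKt t (hts t)
    unfold ksCarterK at hk
    rw [hE t (hts t), hLt t (hts t), div_eq_iff (hΔpos t (hts t)).ne'] at hk
    show blSigma a (E4.spatial (γ t : E4)) ^ 2 * fderiv ℝ (radius a) (γ t) (w t) ^ 2 =
      (a * L) ^ 2 - (radius a (γ t) ^ 2 - 2 * M * radius a (γ t) + a ^ 2) * K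
    linear_combination -hk
  have hturn : ∀ t, ρ t = 0 → Hf t < 0 := by
    intro t hρ0
    have hρ0' : fderiv ℝ (radius a) (γ t) (w t) = 0 := hρ0
    have key := delta_mul_hessAt_radius_eq (M := M) (hx t) (w t)
    rw [hnull' t (hts t), hE t (hts t), hLt t (hts t), hρ0'] at key
    have hr := hrad t
    rw [hρ0] at hr
    have hD := hΔpos t (hts t)
    have hS := hSpos t
    have hfM : M < f t := hMr₁.trans_le (hlo t)
    -- `Δ · 2Σ² H = −(2r − 2M)(aL)²` and `(aL)² = ΔK`
    have h1 : (radius a (γ t) ^ 2 - 2 * M * radius a (γ t) + a ^ 2) *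
        (2 * blSigma a (E4.spatial (γ t : E4)) ^ 2 *
          hessAt (Kerr.bilin M a) (radius a) (γ t) (w t) (w t)) =
        -((2 * radius a (γ t) - 2 * M) * (a * L) ^ 2) := by
      linear_combination key
    have h2 : (a * L) ^ 2 = (radius a (γ t) ^ 2 - 2 * M * radius a (γ t) + a ^ 2) * K := by
      have : blSigma a (E4.spatial (γ t : E4)) ^ 2 * (0 : ℝ) ^ 2 =
          (a * L) ^ 2 - (radius a (γ t) ^ 2 - 2 * M * radius a (γ t) + a ^ 2) * K := hr
      linarith
    show hessAt (Kerr.bilin M a) (radius a) (γ t) (w t) (w t) < 0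
    by_contra hH
    push Not at hH
    have h3 : 0 ≤ (radius a (γ t) ^ 2 - 2 * M * radius a (γ t) + a ^ 2) *
        (2 * blSigma a (E4.spatial (γ t : E4)) ^ 2 *
          hessAt (Kerr.bilin M a) (radius a) (γ t) (w t) (w t)) := by positivity
    have h4 : 0 < (2 * radius a (γ t) - 2 * M) * (a * L) ^ 2 := by
      rw [h2]
      have : 0 < 2 * radius a (γ t) - 2 * M := by
        have : M < radius a (γ t) := hfM
        linarith
      positivity
    linarith
  exact radial_core (Smax := r₂ ^ 2 + a ^ 2) hMr₁ hK hSmax hfd hρd hlo hrad hturn hSpos hSle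

end Summit.FinalStateConjecture.FinalStateConjecture.Theorems

end
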